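import Summits.FinalStateConjecture.FinalStateConjecture.Theses.EIHFluxBalance
import Summits.FinalStateConjecture.FinalStateConjecture.Theorems.EIHFluxBalanceModulatedKerrHandoffTameReduction
import Summits.FinalStateConjecture.FinalStateConjecture.Theorems.EIHFluxBalanceModulatedKerrHandoffTameExistsForm

/-!
# Line `Sketch` (tame template: breathe ∘ trim ∘ kick) — reduction skeleton v2 for the crux
# `EIHFluxBalance.ModulatedKerrHandoff` (item stmt-FinalStateConjecture-17402, H′ = the TAME re-type)

Lead prover `prover-line-stmt-FinalStateConjecture-17402-0`, 2026-08-17 (v1 registered 00:42Z with four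
stubs; v2 after waves 1–2). Cards: `Ideas/tame-template-breathe-trim-kick.md` (ideator 2, whose
`Sketch.lean` seats this line) and `Ideas/trim-on-the-cure.md` (ideator 1).

## Shape (v2): the crux is EQUIVALENT to ONE stub, everything else is landed

The crux is, by `Iff.rfl`, `∀ X, IsTameChristodoulouGeneric (admissibleVacuumData X) (HandoffPropT X) 1`
(`HandoffPropT`/`HandoffClause`/`HandoffAnsatz`: `Theorems/…TameDefs.lean`, p134072/p135488). A tame
witness through an exceptional datum must be (i) TAME on one end, (ii) IMMERSED at `0`, (iii) INJECTIVE,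
(iv) admissible, (v) good at EVERY `c ≠ 0`, where "good" = (vi) an MGHD exists AND EVERY MGHD has complete
`𝓘⁺` and the modulated ansatz with handoff. Landed theorems of this line make (ii), (iii), the
globalisation and two-sidedness of (v), and the `∀ MGHD` of (vi) FREE:

* wave 1 — `stub_breatheTame` p134464, `stub_breatheImmersed` p134749, `stub_injOn_of_immersed` p135009
  (breathing a tame curve member-wise is tame on the collared end, immersed for a suitable rate, hence
  window-injective); transport along re-indexing `Theorems/…TameTransport.lean` p136175
  (`handoffClause_precomp_iff`, `handoffPropT_comap_iff`, `handoffPropT_breatheFamily`);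
  `Theorems/…TameReduction.lean` (`exists_tameWindowWitness_of_tameCurve`,
  `modulatedKerrHandoff_of_tameEscape`, `…OneSided`, converse `tameEscape_of_modulatedKerrHandoff`,
  `exists_tameCurve_of_oneSided`);
* wave 2 — isometry-of-developments transport `stub_rayTransport` p135693,
  `stub_raysStayInClosure_transport` p135804, `stub_cni_transport` p136002,
  `stub_handoffAnsatz_transport` p136463; `Theorems/…TameExistsForm.lean` (`handoffClause_of_isIsometricTo`,
  `handoffPropT_iff_exists`: ONE maximal development suffices, by `mghd_unique_cauchy`).

What remains is ONE stub, the reshaped open core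

  `stub_tameEscapeExists` : through every admissible datum failing the handoff property passes a TAME
  curve of admissible data (no immersion, no injectivity asked) whose members with `0 < c₀ < ε`
  (ONE side) admit ONE maximal vacuum Cauchy development with complete `𝓘⁺` and the modulated
  multi-Kerr–Schild ansatz with handoff —

the large-data final-state content for the escaping members (censorship, capture into receding
sub-extremal Kerr basins, convergence of masses/spins, lab-chart synthesis with the weights and (T), (O),
(R), (QS)), conceded by every card of the crux; the card's `SmoothKerrEndTrimming ⊕ CoreKickGenericity ⊕
FarFieldInsensitivity` and trim-on-the-cure's trim door are templates for producing the curve `F`. The crux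
conversely implies the stub (`tameEscape_of_modulatedKerrHandoff` + `handoffPropT_iff_exists`), so the
reduction is lossless.

Disproof used: tree `Disproof.lean` gen 3 / cycle 1 (ported to H′, NO KILL): §4 constraints / `T2Space` /
`IsMaximal` load-bearing — honoured (members are constraint-solving admissible data; maximality enters via
`IsMaximal.precomp` and `mghd_unique_cauchy`); §11 receding-only families not immersed — the reason breathing
is in the composition; §14 transport modulo (R)/CNI — both now landed (B0–B2). Refuter rattack 17402:
SURVIVES; its "tame tail-trimming escape families plausible, smooth c-dependence unfiled" is inside the stub.
-/

set_option linter.dupNamespace false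

noncomputable section

namespace Summit.FinalStateConjecture.FinalStateConjecture.Cruxes.ModulatedKerrHandoff.TameTemplate

open scoped Topology Manifold ContDiff
open Filter Set Function TopologicalSpace Literature.Geometry.Lorentzian InitialDataSet
open Summit.FinalStateConjecture.FinalStateConjecture.Theses.EIHFluxBalance
open Summit.FinalStateConjecture.FinalStateConjecture.Theorems.EIHFluxBalance.TameTemplate

/-- FAITHFULNESS: the crux is literally tame Christodoulou genericity of `HandoffPropT`, `Σ` by `Σ`. -/
theorem modulatedKerrHandoff_iff :
    ModulatedKerrHandoff ↔
      ∀ (X : Type) [TopologicalSpace X] [ChartedSpace E3 X] [IsManifold (𝓡 3) ((⊤ : ℕ∞) : WithTop ℕ∞) X] [T2Space X] [SecondCountableTopology X] [ConnectedSpace X],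
        IsTameChristodoulouGeneric (admissibleVacuumData X) (HandoffPropT X) 1 :=
  Iff.rfl

/-- **STUB S1″ — TAME ESCAPE, ONE-SIDED, ONE MAXIMAL DEVELOPMENT (the reshaped open core; held by the
lead).** Through every admissible datum failing the handoff property passes a TAME one-parameter family of
admissible data (jointly smooth, one fixed end, Dafermos–Rodnianski decay with continuous mass,
`wDist`-continuous at `0`; immersion and injectivity NOT asked), whose members with `0 < c₀ < ε` admit ONE
maximal vacuum Cauchy development with complete `𝓘⁺` and the modulated multi-Kerr–Schild ansatz with the
handoff clauses (`HandoffClause`). Equivalent to the crux given the landed files. -/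
theorem stub_tameEscapeExists :
    ∀ (X : Type) [TopologicalSpace X] [ChartedSpace E3 X] [IsManifold (𝓡 3) ((⊤ : ℕ∞) : WithTop ℕ∞) X] [T2Space X] [SecondCountableTopology X] [ConnectedSpace X], ∀ d ∈ admissibleVacuumData X, ¬ HandoffPropT X d → ∃ (e : AFEnd X) (F : EuclideanSpace ℝ (Fin 1) → InitialDataSet (𝓡 3) X), IsTameDataFamily e 1 F ∧ F 0 = d ∧ (∀ c, F c ∈ admissibleVacuumData X) ∧ ∃ ε > (0 : ℝ), ∀ c, 0 < c 0 → c 0 < ε → ∃ 𝒟 : VacuumCauchyDevelopment (F c), 𝒟.IsMaximal ∧ HandoffClause X (F c) 𝒟 := by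
  sorry

/-- **COMPOSITION (v2).** `ModulatedKerrHandoff` from S1″: one maximal development suffices
(`handoffPropT_iff_exists`), one side of the parameter suffices and immersion / injectivity / window →
global are free (`modulatedKerrHandoff_of_tameEscapeOneSided`). -/
theorem ModulatedKerrHandoff_of : ModulatedKerrHandoff :=
  modulatedKerrHandoff_of_tameEscapeOneSided fun X _ _ _ _ _ _ d hd hP ↦ by
    obtain ⟨e, F, hF, h0, h𝓓, ε, hε, hgood⟩ := stub_tameEscapeExists X d hd hP
    exact ⟨e, F, hF, h0, h𝓓, ε, hε, fun c hc hcε ↦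
      (handoffPropT_iff_exists X (F c)).2 (hgood c hc hcε)⟩

/-- **CONVERSELY the crux implies S1″** (so the reduction is lossless). -/
theorem tameEscapeExists_of_modulatedKerrHandoff (h : ModulatedKerrHandoff) :
    ∀ (X : Type) [TopologicalSpace X] [ChartedSpace E3 X] [IsManifold (𝓡 3) ((⊤ : ℕ∞) : WithTop ℕ∞) X] [T2Space X] [SecondCountableTopology X] [ConnectedSpace X], ∀ d ∈ admissibleVacuumData X, ¬ HandoffPropT X d → ∃ (e : AFEnd X) (F : EuclideanSpace ℝ (Fin 1) → InitialDataSet (𝓡 3) X), IsTameDataFamily e 1 F ∧ F 0 = d ∧ (∀ c, F c ∈ admissibleVacuumData X) ∧ ∃ ε > (0 : ℝ), ∀ c, 0 < c 0 → c 0 < ε → ∃ 𝒟 : VacuumCauchyDevelopment (F c), 𝒟.IsMaximal ∧ HandoffClause X (F c) 𝒟 := by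
  intro X _ _ _ _ _ _ d hd hP
  obtain ⟨e, F, hF, h0, h𝓓, ε, hε, hgood⟩ := tameEscape_of_modulatedKerrHandoff h X d hd hP
  refine ⟨e, F, hF, h0, h𝓓, ε, hε, fun c hc hcε ↦ (handoffPropT_iff_exists X (F c)).1 (hgood c ?_ ?_)⟩
  · intro h0c
    rw [h0c] at hc
    exact lt_irrefl _ hc
  · have : ‖c‖ = |c 0| := by
      rw [EuclideanSpace.norm_eq c, Fin.sum_univ_one, Real.norm_eq_abs, Real.sqrt_sq (abs_nonneg _)]
    rw [this, abs_of_pos hc]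
    exact hcε

end Summit.FinalStateConjecture.FinalStateConjecture.Cruxes.ModulatedKerrHandoff.TameTemplate

end
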